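import Literature.Probability.Percolation.PercolationEvents
import Literature.Probability.LatticeModels.ProdBernoulliIndependence
import HarnessLib

/-!
# Pairs of weight one: the sure component of the port, transfer of the port, and the closed case

Support file for crux `stmt-CriticalPhenomena-4575` (`NoHeavyLowerTail`), seat `prim-l12-p1` gen 22 (`--supports stmt-CriticalPhenomena-4575`);
memo `run/shared/lean/prim/prim-l12/FROM-prim-l12-p1-g22-CHALF-ALL-GRAPHS.md`.  Second of three graph-level files proving the sextic isolation law
`(Q6)` and the face inequality `(C½)` on EVERY finite weighted graph (`…ThreePointIsoSexticOneBond`, `…ThreePointIsoSexticAllGraphs`); this one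
handles the pairs of weight ONE, which the induction on the number of fractional pairs (weights in `(0,1)`) of `…AllGraphs` cannot touch.
Bond percolation `μ = prodBernoulli w`, `w : Sym2 V → [0,1]`, finite `V`; the SURE COMPONENT of `c` is `K = {v | c ↔ v through pairs of weight 1}`
(written `(openGraph {e | w e = 1}).Reachable c v`).

* `ae_mem_of_weight_eq_one`, `ae_reachable_of_sure`, `real_openConn_eq_one_of_sure` — almost surely every weight-one pair is open, so `K ⊆ C(c)`
  a.s. and `μ(c ↔ u) = 1` for `u ∈ K`.
* `transfer` — if `μ(c ↔ u) = 1` the four isolation coordinates `μ(a|b|c)`, `μ(I_c)`, `μ(I_b)`, `μ(I_a)` of `(a,b;c)` equal those of `(a,b;u)`.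
* `real_sep_eq_zero_of_sure` — `a ∈ K ⟹ μ(a|b|c) = 0`.
* `isoSexticPort_of_closedSure` — if `a, b ∉ K` and NO pair `ux` (`u ∈ K`, `x ∉ K`) has weight in `(0,1)`, then all such pairs have weight `0`,
  a.s. `C(c) = K`, hence `μ(I_c) = 1`, `μ(a|b|c) = μ(I_a) = μ(I_b) = μ(a ≁ b)` and the port component `μ(a|b|c)⁶ ≤ μ(I_c)²μ(I_b)³μ(I_a)³` holds
  (with equality).
* `card_fractional_update_lt` — forcing a fractional weight to `0` or `1` lowers the number of fractional pairs (the induction measure).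
No definitions, no sorries, standard axioms.
-/

namespace Summit.CriticalPhenomena.PercolationContinuityZ3.Theorems.ThreePointIsoSexticSureComponent

open MeasureTheory Set Filter
open Literature.Probability.Percolation Literature.Probability.LatticeModels
open scoped Classical

variable {V : Type*} [Fintype V]

/-! ## Pairs of weight one: the sure component -/

/-- Almost surely every pair of weight `1` is open. [folklore] -/
theorem ae_mem_of_weight_eq_one (w : Sym2 V → unitInterval) :
    ∀ᵐ ω ∂(prodBernoulli w), ∀ e : Sym2 V, (w e : ℝ) = 1 → e ∈ ω := by
  rw [ae_all_iff]
  intro e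
  by_cases he : (w e : ℝ) = 1
  · have h0 : (prodBernoulli w).real {ω | e ∉ ω} = 0 := by rw [prodBernoulli_real_setOf_notMem, he, sub_self]
    have h0' : (prodBernoulli w) {ω | e ∉ ω} = 0 := (measureReal_eq_zero_iff (by finiteness)).1 h0
    filter_upwards [measure_eq_zero_iff_ae_notMem.1 h0'] with ω hω
    intro _
    simpa using hω
  · exact Eventually.of_forall fun ω h => absurd h he

/-- Almost surely, every vertex joined to `c` by pairs of weight `1` is joined to `c` by an open path. [folklore] -/
theorem ae_reachable_of_sure (w : Sym2 V → unitInterval) :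
    ∀ᵐ ω ∂(prodBernoulli w), ∀ c v : V, (openGraph {e : Sym2 V | (w e : ℝ) = 1}).Reachable c v → (openGraph ω).Reachable c v := by
  filter_upwards [ae_mem_of_weight_eq_one w] with ω hω
  intro c v h
  exact h.mono (openGraph_mono fun e he => hω e he)

/-- A vertex `u` joined to `c` by pairs of weight `1` is almost surely in the cluster of `c`: `μ(c ↔ u) = 1`. [folklore] -/
theorem real_openConn_eq_one_of_sure (w : Sym2 V → unitInterval) {c u : V}
    (h : (openGraph {e : Sym2 V | (w e : ℝ) = 1}).Reachable c u) : (prodBernoulli w).real (openConn c u) = 1 := by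
  have hc : (prodBernoulli w) (openConn c u : Set (BondConfig V))ᶜ = 0 := by
    rw [measure_eq_zero_iff_ae_notMem]
    filter_upwards [ae_reachable_of_sure w] with ω hω
    simp only [mem_compl_iff, not_not]
    exact hω c u h
  have h1 : (prodBernoulli w) (openConn c u : Set (BondConfig V)) = 1 := (prob_compl_eq_zero_iff MeasurableSet.of_discrete).1 hc
  simp [measureReal_def, h1]

/-- **Transfer of the port along an almost sure connection.**  If `μ(c ↔ u) = 1` then the four isolation coordinates of `(a, b; c)` equal
those of `(a, b; u)`. [this work] -/
theorem transfer (w : Sym2 V → unitInterval) {a b c u : V} (h1 : (prodBernoulli w).real (openConn c u) = 1) :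
    (prodBernoulli w).real ((openConn a b)ᶜ ∩ (openConn a c)ᶜ ∩ (openConn b c)ᶜ) =
        (prodBernoulli w).real ((openConn a b)ᶜ ∩ (openConn a u)ᶜ ∩ (openConn b u)ᶜ) ∧
      (prodBernoulli w).real ((openConn a c)ᶜ ∩ (openConn b c)ᶜ) = (prodBernoulli w).real ((openConn a u)ᶜ ∩ (openConn b u)ᶜ) ∧
      (prodBernoulli w).real ((openConn a b)ᶜ ∩ (openConn b c)ᶜ) = (prodBernoulli w).real ((openConn a b)ᶜ ∩ (openConn b u)ᶜ) ∧
      (prodBernoulli w).real ((openConn a b)ᶜ ∩ (openConn a c)ᶜ) = (prodBernoulli w).real ((openConn a b)ᶜ ∩ (openConn a u)ᶜ) := by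
  set μ := prodBernoulli w with hμ
  have h1' : μ (openConn c u : Set (BondConfig V)) = 1 := by
    rw [measureReal_def] at h1
    exact (ENNReal.toReal_eq_one_iff _).1 h1
  have hae : ∀ᵐ ω ∂μ, ω ∈ (openConn c u : Set (BondConfig V)) := (mem_ae_iff_prob_eq_one MeasurableSet.of_discrete).2 h1'
  have hp : ∀ p : V, ((openConn p c : Set (BondConfig V)) : Set (BondConfig V)) =ᵐ[μ] (openConn p u : Set (BondConfig V)) := by
    intro p
    rw [eventuallyEq_set]
    filter_upwards [hae] with ω hω
    simp only [openConn, mem_setOf_eq] at hω ⊢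
    exact ⟨fun h => h.trans hω, fun h => h.trans hω.symm⟩
  have hac := (hp a).compl
  have hbc := (hp b).compl
  refine ⟨measureReal_congr ?_, measureReal_congr ?_, measureReal_congr ?_, measureReal_congr ?_⟩
  · exact (EventuallyEq.rfl.inter hac).inter hbc
  · exact hac.inter hbc
  · exact EventuallyEq.rfl.inter hbc
  · exact EventuallyEq.rfl.inter hac

/-- If `μ(a ↔ c) = 1`-type degeneracy: when `c` is surely joined to `a`, `μ(a|b|c) = 0`. [this work] -/
theorem real_sep_eq_zero_of_sure (w : Sym2 V → unitInterval) {a b c : V}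
    (h : (openGraph {e : Sym2 V | (w e : ℝ) = 1}).Reachable c a) :
    (prodBernoulli w).real ((openConn a b)ᶜ ∩ (openConn a c)ᶜ ∩ (openConn b c)ᶜ) = 0 := by
  have hc : (prodBernoulli w) (openConn a c : Set (BondConfig V))ᶜ = 0 := by
    rw [measure_eq_zero_iff_ae_notMem]
    filter_upwards [ae_reachable_of_sure w] with ω hω
    simp only [mem_compl_iff, not_not, openConn, mem_setOf_eq]
    exact (hω c a h).symm
  have : (prodBernoulli w) ((openConn a b)ᶜ ∩ (openConn a c)ᶜ ∩ (openConn b c)ᶜ : Set (BondConfig V)) = 0 :=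
    measure_mono_null (fun ω hω => hω.1.2) hc
  simp [measureReal_def, this]

/-- **No fractional pair leaves the sure component.**  If `a, b ∉ K` (the vertices surely joined to `c`) and no pair `ux`, `u ∈ K`, `x ∉ K`,
has weight in `(0,1)`, then almost surely `C(c) = K`, so `I_c = 1`, `Q = I_a = I_b = μ(a ≁ b)` and the port component of `(Q6)` holds
(with equality). [this work] -/
theorem isoSexticPort_of_closedSure (w : Sym2 V → unitInterval) {a b c : V}
    (hKa : ¬ (openGraph {e : Sym2 V | (w e : ℝ) = 1}).Reachable c a) (hKb : ¬ (openGraph {e : Sym2 V | (w e : ℝ) = 1}).Reachable c b)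
    (hB : ¬ ∃ u x : V, (openGraph {e : Sym2 V | (w e : ℝ) = 1}).Reachable c u ∧ ¬ (openGraph {e : Sym2 V | (w e : ℝ) = 1}).Reachable c x ∧
      (0 : ℝ) < w s(u, x) ∧ (w s(u, x) : ℝ) < 1) :
    (prodBernoulli w).real ((openConn a b)ᶜ ∩ (openConn a c)ᶜ ∩ (openConn b c)ᶜ) ^ 6 ≤
      (prodBernoulli w).real ((openConn a c)ᶜ ∩ (openConn b c)ᶜ) ^ 2 *
        (prodBernoulli w).real ((openConn a b)ᶜ ∩ (openConn b c)ᶜ) ^ 3 *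
          (prodBernoulli w).real ((openConn a b)ᶜ ∩ (openConn a c)ᶜ) ^ 3 := by
  set μ := prodBernoulli w with hμ
  set G1 : SimpleGraph V := openGraph {e : Sym2 V | (w e : ℝ) = 1} with hG1
  -- every pair leaving the sure component `K = {v | G1.Reachable c v}` has weight `0`
  have hzero : ∀ u x : V, G1.Reachable c u → ¬ G1.Reachable c x → (w s(u, x) : ℝ) = 0 := by
    intro u x hu hx
    have h0 : (0 : ℝ) ≤ w s(u, x) := (w s(u, x)).2.1
    have h1 : (w s(u, x) : ℝ) ≤ 1 := (w s(u, x)).2.2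
    rcases h0.eq_or_lt with h | hpos
    · exact h.symm
    rcases h1.eq_or_lt' with h | hlt
    · -- weight `1`: then `x ∈ K`
      exfalso
      have hux : u ≠ x := fun hux => hx (hux ▸ hu)
      have hadj : G1.Adj u x := by
        rw [hG1, openGraph_adj]
        exact ⟨h.symm, hux⟩
      exact hx (hu.trans hadj.reachable)
    · exact (hB ⟨u, x, hu, hx, hpos, hlt⟩).elim
  -- hence almost surely all these pairs are closed
  have hclosed : ∀ᵐ ω ∂μ, ∀ u x : V, G1.Reachable c u → ¬ G1.Reachable c x → s(u, x) ∉ ω := by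
    have : ∀ᵐ ω ∂μ, ∀ p : V × V, G1.Reachable c p.1 → ¬ G1.Reachable c p.2 → s(p.1, p.2) ∉ ω := by
      rw [ae_all_iff]
      rintro ⟨u, x⟩
      by_cases hux : G1.Reachable c u ∧ ¬ G1.Reachable c x
      · have h0 : μ.real {ω | s(u, x) ∈ ω} = 0 := by rw [hμ, prodBernoulli_real_setOf_mem, hzero u x hux.1 hux.2]
        have h0' : μ {ω | s(u, x) ∈ ω} = 0 := (measureReal_eq_zero_iff (by finiteness)).1 h0
        filter_upwards [measure_eq_zero_iff_ae_notMem.1 h0'] with ω hω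
        intro _ _
        simpa using hω
      · exact Eventually.of_forall fun ω h h' => (hux ⟨h, h'⟩).elim
    filter_upwards [this] with ω hω
    exact fun u x hu hx => hω (u, x) hu hx
  -- so almost surely the cluster of `c` is inside `K`
  have hcluster : ∀ᵐ ω ∂μ, ∀ v : V, (openGraph ω).Reachable c v → G1.Reachable c v := by
    filter_upwards [hclosed] with ω hω
    intro v hv
    by_contra hKv
    obtain ⟨p⟩ := hv
    obtain ⟨d, -, hd1, hd2⟩ := p.exists_boundary_dart {y | G1.Reachable c y} (SimpleGraph.Reachable.refl c) hKv
    have hadj := d.adj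
    rw [openGraph_adj] at hadj
    exact hω _ _ hd1 hd2 hadj.1
  -- consequences: `a ↮ c`, `b ↮ c` almost surely
  have hac : ((openConn a c : Set (BondConfig V))ᶜ : Set (BondConfig V)) =ᵐ[μ] (univ : Set (BondConfig V)) := by
    rw [eventuallyEq_set]
    filter_upwards [hcluster] with ω hω
    simp only [mem_compl_iff, openConn, mem_setOf_eq, mem_univ, iff_true]
    exact fun h => hKa (hω a h.symm)
  have hbc : ((openConn b c : Set (BondConfig V))ᶜ : Set (BondConfig V)) =ᵐ[μ] (univ : Set (BondConfig V)) := by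
    rw [eventuallyEq_set]
    filter_upwards [hcluster] with ω hω
    simp only [mem_compl_iff, openConn, mem_setOf_eq, mem_univ, iff_true]
    exact fun h => hKb (hω b h.symm)
  have eC : μ.real ((openConn a c)ᶜ ∩ (openConn b c)ᶜ) = 1 := by
    rw [measureReal_congr (hac.inter hbc), inter_univ, probReal_univ]
  have eS : μ.real ((openConn a b)ᶜ ∩ (openConn a c)ᶜ ∩ (openConn b c)ᶜ) = μ.real (openConn a b : Set (BondConfig V))ᶜ := by
    rw [measureReal_congr ((EventuallyEq.rfl.inter hac).inter hbc), inter_univ, inter_univ]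
  have eB : μ.real ((openConn a b)ᶜ ∩ (openConn b c)ᶜ) = μ.real (openConn a b : Set (BondConfig V))ᶜ := by
    rw [measureReal_congr (EventuallyEq.rfl.inter hbc), inter_univ]
  have eA : μ.real ((openConn a b)ᶜ ∩ (openConn a c)ᶜ) = μ.real (openConn a b : Set (BondConfig V))ᶜ := by
    rw [measureReal_congr (EventuallyEq.rfl.inter hac), inter_univ]
  rw [eC, eS, eB, eA]
  exact le_of_eq (by ring)

/-! ## The induction measure -/

variable [DecidableEq V]

/-- Forcing a fractional weight to `0` or `1` lowers the number of fractional pairs. [this work] -/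
theorem card_fractional_update_lt (w : Sym2 V → unitInterval) {e : Sym2 V} (he0 : (0 : ℝ) < w e) (he1 : (w e : ℝ) < 1)
    (t : unitInterval) (ht : (t : ℝ) = 0 ∨ (t : ℝ) = 1) :
    (Finset.univ.filter fun f : Sym2 V => (0 : ℝ) < Function.update w e t f ∧ (Function.update w e t f : ℝ) < 1).card <
      (Finset.univ.filter fun f : Sym2 V => (0 : ℝ) < w f ∧ (w f : ℝ) < 1).card := by
  have hmem : e ∈ Finset.univ.filter fun f : Sym2 V => (0 : ℝ) < w f ∧ (w f : ℝ) < 1 := by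
    rw [Finset.mem_filter]; exact ⟨Finset.mem_univ _, he0, he1⟩
  refine lt_of_le_of_lt (Finset.card_le_card ?_) (Finset.card_erase_lt_of_mem hmem)
  intro f hf
  rw [Finset.mem_filter] at hf
  rw [Finset.mem_erase, Finset.mem_filter]
  rcases eq_or_ne f e with rfl | hne
  · rw [Function.update_self] at hf
    rcases ht with h | h <;> rw [h] at hf
    · exact (lt_irrefl _ hf.2.1).elim
    · exact (lt_irrefl _ hf.2.2).elim
  · rw [Function.update_of_ne hne] at hf
    exact ⟨hne, Finset.mem_univ _, hf.2⟩

end Summit.CriticalPhenomena.PercolationContinuityZ3.Theorems.ThreePointIsoSexticSureComponent
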